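import Mathlib.Analysis.Calculus.FDeriv.Extend
import Mathlib.Analysis.Calculus.ContDiff.Basic
import Mathlib.Analysis.Calculus.Taylor
import Mathlib.Analysis.Normed.Module.HahnBanach
import Literature.Analysis.Calculus.LineRestrictionIteratedDeriv   -- ★ `iteratedDeriv_lineRestriction` (1-D restriction of `iteratedFDeriv`)
import HarnessLib

/-!
# Functions flat along a zero section: `C^∞` across the section from off-section flatness, and super-polynomial smallness of all derivatives

For a product `F × P` of real normed spaces («variable» `w ∈ F` first, «parameter» `z ∈ P` last) the ZERO SECTION is `{0} × P` and the OFF-SECTION open set is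
`{q : F × P | q.1 ≠ 0}`.  All derivatives are Mathlib's GLOBAL `iteratedFDeriv ℝ n f` (on the open off-section set it agrees with the within-derivative,
`iteratedFDerivWithin_of_isOpen`).  No finite-dimensionality and no completeness is assumed anywhere (`F = ℝ × ℝ`, `ℂ`, `EuclideanSpace ℝ (Fin k)` are the
intended instances).  THEOREMS ONLY; Mathlib + ★ `LineRestrictionIteratedDeriv`.

* §1 `hasFDerivAt_zero_zeroSection_of_tendsto` — ONE STEP: `g` differentiable off the section, `0` on it, `g → 0` and `fderiv g → 0` at section points from the
  off-section side ⇒ `HasFDerivAt g 0 (0, z)`.  Proof: Mathlib `hasFDerivWithinAt_closure_of_tendsto_fderiv` on the two open CONVEX half-spaces `{0 < ±ℓ q.1}` of a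
  Hahn–Banach functional `ℓ` (`exists_dual_vector`) — they do not cover the off-section set when `dim F ≥ 2`, but their CLOSURES cover `F × P`, which is all that
  `HasFDerivWithinAt.union` needs; `Subsingleton F` apart (then `g ≡ 0`).
* §2 **B7 (i)** `contDiff_of_iteratedFDeriv_tendsto_zero_zeroSection`: `C^∞` off the section + value `0` on it + EVERY `Dⁿf → 0` at every section point from the
  off-section side ⇒ `C^∞` on `F × P` with all derivatives `0` on the section (induction on the order through §1 and `fderiv (Dⁿf) = curryLeft ∘ Dⁿ⁺¹f`, then
  `contDiff_of_differentiable_iteratedFDeriv`); bound-currency twin `contDiff_of_norm_iteratedFDeriv_le_zeroSection` (`‖Dⁿf q‖ ≤ C‖q.1‖` near each section point).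
* §3 **B7 (ii)** `isBigO_iteratedFDeriv_norm_fst_pow_of_zeroSection`: `C^∞` with ALL derivatives `0` on the section ⇒ `Dⁿf = O(‖q.1‖^N)` near every section point,
  every `n, N` — 1-D Taylor (`taylor_mean_remainder_bound`) on the `F`-segment `s ↦ (s • q.1, q.2)` with the ZERO Taylor polynomial, the top derivative bounded by
  `1 · ‖q.1‖^N` near the point by continuity (its value on the section is `0`); `‖Dʲ(Dⁿf)‖ = ‖Dⁿ⁺ʲf‖` (`norm_iteratedFDeriv_iteratedFDeriv_eq_norm`) reduces to `n = 0`.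
The value-flat versions (B7 (ii′): `f = O(‖q.1‖^N) ∀N` ⇒ jets vanish on the section, symmetry-free by a Landau–Kolmogorov induction) are in the companion
`FlatZeroSectionValues.lean`.

Context: cell `pub/hodgecm-mathlib`, N8-census §5 (9) GLAESER–CHEVALLEY road G″ for `S₃` (binder LH7-p01 (g6), skeleton `GlaeserSymmetricThree`; LEAD F0P3a-plan
T13-42 priority (5)), brick **B7 «FLAT LEMMAS»** (consumers: D «flat `C₃`-descent» (LH5-p05), the corner chain); count-neutral Literature, `--kind proof --supports
stmt-HodgeConjecture-24833`.  Author LH10-p02 (g8); statement read ref5 (g11) R-711 «=».  HONEST LABEL: HC_CM is proved only modulo the 7 printed citations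
(2 remaining: hLiu418 = `stmt-HodgeConjecture-24832`, h413 = `stmt-HodgeConjecture-24833`) until rung 0 closes; this file pays no organ.

## References
* [HormanderALPDO1] L. Hörmander, *The Analysis of Linear Partial Differential Operators I*, Grundlehren 256, Springer (1983; 2nd ed. 1990), §1.1:
  (1.1.2)″ mean value inequality, Thm. 1.1.5, (1.1.7)–(1.1.8) Taylor's formula, the norm-preserving nesting of multilinear forms; §1.2 Lemma 1.2.3 (`exp(−1/t)` is `C^∞`).
* [Whitney1943] H. Whitney, *Differentiable even functions*, Duke Math. J. 10 (1943) 159–160 (the formal ∕ flat splitting these lemmas serve).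
* [Glaeser1963] G. Glaeser, *Fonctions composées différentiables*, Ann. of Math. 77 (1963) 193–209 (the theorem the road proves for `S₃`).
* [Dieudonne1960] J. Dieudonné, *Foundations of Modern Analysis* (1960), (8.6.2) mean value inequality, (8.14.3) Taylor's formula — the two tools used here.
-/

set_option autoImplicit false

noncomputable section

open Set Filter Topology Asymptotics
open scoped ContDiff

namespace Literature.Analysis.Calculus

variable {F P E : Type*} [NormedAddCommGroup F] [NormedSpace ℝ F] [NormedAddCommGroup P] [NormedSpace ℝ P]
  [NormedAddCommGroup E] [NormedSpace ℝ E]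

/-! ## §1 One step: a function vanishing on the zero section, flat from the off-section side, has derivative `0` at the section -/

/-- **Half-space closure step.**  If `g : F × P → E` is differentiable off the zero section (`{q | q.1 ≠ 0}`), vanishes on the section, tends to `0` at every
section point from the off-section side, and its derivative tends to `0` at `(0, z₀)` from the off-section side, then for every continuous linear functional
`φ` on `F`, `g` has derivative `0` at `(0, z₀)` WITHIN the closure of the open convex half-space `{q | 0 < φ q.1}` (Mathlib
`hasFDerivWithinAt_closure_of_tendsto_fderiv`). [cite: HormanderALPDO1, §1.1 (1.1.2)″ and Thm. 1.1.5 (pp. 8–9)] -/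
theorem hasFDerivWithinAt_zero_closure_halfSpace_of_tendsto {g : F × P → E}
    (hdiff : DifferentiableOn ℝ g {q : F × P | q.1 ≠ 0}) (h0 : ∀ z : P, g (0, z) = 0)
    (hcont : ∀ z : P, Tendsto g (𝓝[{q : F × P | q.1 ≠ 0}] (0, z)) (𝓝 0)) {z₀ : P}
    (hder : Tendsto (fun q => fderiv ℝ g q) (𝓝[{q : F × P | q.1 ≠ 0}] (0, z₀)) (𝓝 0)) (φ : F →L[ℝ] ℝ) :
    HasFDerivWithinAt g (0 : F × P →L[ℝ] E) (closure {q : F × P | 0 < φ q.1}) (0, z₀) := by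
  have hsub : {q : F × P | 0 < φ q.1} ⊆ {q : F × P | q.1 ≠ 0} := by
    intro q hq h0q
    simp only [mem_setOf_eq, h0q, map_zero, lt_self_iff_false] at hq
  refine hasFDerivWithinAt_closure_of_tendsto_fderiv (hdiff.mono hsub) ?_ ?_ ?_ (hder.mono_left (nhdsWithin_mono _ hsub))
  · -- convexity: preimage of a half-line under the linear map `q ↦ φ q.1`
    exact convex_halfSpace_gt ((φ.comp (ContinuousLinearMap.fst ℝ F P)).toLinearMap.isLinear) 0
  · exact isOpen_lt continuous_const (φ.continuous.comp continuous_fst)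
  · intro y _
    by_cases hy : y.1 = 0
    · -- a section point: `g y = 0` and `g → 0` from the off-section side
      have hy' : y = ((0 : F), y.2) := Prod.ext hy rfl
      rw [ContinuousWithinAt, hy', h0]
      exact (hcont y.2).mono_left (nhdsWithin_mono _ hsub)
    · exact ((hdiff y hy).differentiableAt ((isOpen_ne_fun continuous_fst continuous_const).mem_nhds hy)).continuousAt.continuousWithinAt

/-- **Derivative `0` at the section.**  Under the hypotheses of `hasFDerivWithinAt_zero_closure_halfSpace_of_tendsto`, `g` has Fréchet derivative `0` at `(0, z₀)`:
the closures of the two half-spaces `{0 < ℓ q.1}`, `{0 < -ℓ q.1}` of a Hahn–Banach functional `ℓ ≠ 0` cover `F × P` (when `F` is trivial, `g ≡ 0`). [cite: HormanderALPDO1, §1.1 (1.1.2)″ and Thm. 1.1.5 (pp. 8–9)] -/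
theorem hasFDerivAt_zero_zeroSection_of_tendsto {g : F × P → E}
    (hdiff : DifferentiableOn ℝ g {q : F × P | q.1 ≠ 0}) (h0 : ∀ z : P, g (0, z) = 0)
    (hcont : ∀ z : P, Tendsto g (𝓝[{q : F × P | q.1 ≠ 0}] (0, z)) (𝓝 0)) {z₀ : P}
    (hder : Tendsto (fun q => fderiv ℝ g q) (𝓝[{q : F × P | q.1 ≠ 0}] (0, z₀)) (𝓝 0)) :
    HasFDerivAt g (0 : F × P →L[ℝ] E) (0, z₀) := by
  rcases subsingleton_or_nontrivial F with hF | hF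
  · -- every point lies on the section: `g` is identically zero
    have hg : g = fun _ => 0 := by
      funext q
      rw [show q = ((0 : F), q.2) from Prod.ext (Subsingleton.elim _ _) rfl]
      exact h0 q.2
    rw [hg]
    exact hasFDerivAt_const (0 : E) _
  · obtain ⟨w₁, hw₁⟩ := exists_ne (0 : F)
    obtain ⟨ℓ, -, hℓ⟩ := exists_dual_vector ℝ w₁ (norm_ne_zero_iff.2 hw₁)
    have hℓpos : 0 < ℓ w₁ := by
      rw [hℓ]
      exact_mod_cast norm_pos_iff.2 hw₁
    have hplus := hasFDerivWithinAt_zero_closure_halfSpace_of_tendsto hdiff h0 hcont hder ℓ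
    have hminus := hasFDerivWithinAt_zero_closure_halfSpace_of_tendsto hdiff h0 hcont hder (-ℓ)
    refine (hplus.union hminus).hasFDerivAt (Filter.univ_mem' fun q => ?_)
    -- every `q` lies in the closure of one of the two half-spaces: approach along `q + t • (±w₁, 0)`, `t → 0⁺`
    have key : ∀ (ψ : F →L[ℝ] ℝ) (w : F), 0 < ψ w → 0 ≤ ψ q.1 → q ∈ closure {q : F × P | 0 < ψ q.1} := by
      intro ψ w hw hq
      have hlim : Tendsto (fun t : ℝ => (q.1 + t • w, q.2)) (𝓝[>] 0) (𝓝 q) := by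
        have hc : Continuous fun t : ℝ => (q.1 + t • w, q.2) := by fun_prop
        have := hc.tendsto 0
        simp only [zero_smul, add_zero, Prod.mk.eta] at this
        exact this.mono_left nhdsWithin_le_nhds
      refine mem_closure_of_tendsto hlim (eventually_mem_nhdsWithin.mono fun t ht => ?_)
      simp only [mem_setOf_eq, map_add, map_smul, smul_eq_mul]
      exact add_pos_of_nonneg_of_pos hq (mul_pos ht hw)
    rcases le_total 0 (ℓ q.1) with hq | hq
    · exact Or.inl (key ℓ w₁ hℓpos hq)
    · refine Or.inr (key (-ℓ) (-w₁) ?_ ?_)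
      · simpa only [neg_apply, map_neg, neg_neg] using hℓpos
      · simpa only [neg_apply, neg_nonneg] using hq

/-! ## §2 B7 (i): smooth off the section + all derivatives flat at the section ⇒ smooth across, all derivatives `0` on the section -/

/-- **Induction core.**  `f` is `C^∞` off the zero section, vanishes on it, and every global iterated derivative `Dⁿf` tends to `0` at every section point from the
off-section side.  Then for every `n`: `Dⁿf` vanishes on the section and has Fréchet derivative `0` at every section point. [cite: HormanderALPDO1, §1.1 (1.1.2)″ (p. 9); §1.2 Lemma 1.2.3 with Example 1.1.3 (p. 14)] -/
theorem iteratedFDeriv_zeroSection_eq_zero_and_hasFDerivAt {f : F × P → E}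
    (hf : ContDiffOn ℝ ∞ f {q : F × P | q.1 ≠ 0}) (h0 : ∀ z : P, f (0, z) = 0)
    (hflat : ∀ (n : ℕ) (z : P), Tendsto (fun q => iteratedFDeriv ℝ n f q) (𝓝[{q : F × P | q.1 ≠ 0}] (0, z)) (𝓝 0)) (n : ℕ) :
    (∀ z : P, iteratedFDeriv ℝ n f (0, z) = 0) ∧ ∀ z : P, HasFDerivAt (iteratedFDeriv ℝ n f) (0 : F × P →L[ℝ] _) (0, z) := by
  have hs : IsOpen {q : F × P | q.1 ≠ 0} := isOpen_ne_fun continuous_fst continuous_const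
  -- off the section every iterated derivative is differentiable
  have hdiff : ∀ m : ℕ, DifferentiableOn ℝ (iteratedFDeriv ℝ m f) {q : F × P | q.1 ≠ 0} := fun m q hq =>
    ((hf.contDiffAt (hs.mem_nhds hq)).differentiableAt_iteratedFDeriv (by exact_mod_cast ENat.coe_lt_top m)).differentiableWithinAt
  -- the step: vanishing on the section ⇒ derivative `0` at the section
  have step : ∀ m : ℕ, (∀ z : P, iteratedFDeriv ℝ m f (0, z) = 0) →
      ∀ z : P, HasFDerivAt (iteratedFDeriv ℝ m f) (0 : F × P →L[ℝ] _) (0, z) := by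
    intro m hm z
    refine hasFDerivAt_zero_zeroSection_of_tendsto (hdiff m) hm (fun z' => hflat m z') ?_
    -- `fderiv (Dᵐf) = curryLeft ∘ Dᵐ⁺¹f`
    rw [fderiv_iteratedFDeriv]
    have hc := (continuousMultilinearCurryLeftEquiv ℝ (fun _ : Fin (m + 1) => F × P) E).continuous.tendsto 0
    rw [LinearIsometryEquiv.map_zero] at hc
    exact hc.comp (hflat (m + 1) z)
  induction n with
  | zero =>
    have hz : ∀ z : P, iteratedFDeriv ℝ 0 f (0, z) = 0 := fun z => by
      ext v
      rw [iteratedFDeriv_zero_apply, h0, zero_apply]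
    exact ⟨hz, step 0 hz⟩
  | succ n ih =>
    have hz : ∀ z : P, iteratedFDeriv ℝ (n + 1) f (0, z) = 0 := fun z => by
      rw [iteratedFDeriv_succ_eq_comp_left, Function.comp_apply, (ih.2 z).fderiv, LinearIsometryEquiv.map_zero]
    exact ⟨hz, step (n + 1) hz⟩

/-- **B7 (i) — FLAT ACROSS A ZERO SECTION.**  Let `f : F × P → E` be `C^∞` on the open set `{q | q.1 ≠ 0}` off the zero section `{0} × P`, vanish on the section,
and let EVERY global iterated derivative `Dⁿf` tend to `0` at every section point from the off-section side.  Then `f` is `C^∞` on all of `F × P` and all its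
derivatives vanish on the section (the classical «a function flat at a submanifold from the outside is smooth across it»; `F = ℝᵏ`, `ℂ`, … in the applications; no
finite-dimensionality or completeness needed). [cite: HormanderALPDO1, §1.1 (1.1.2)″ (p. 9); §1.2 Lemma 1.2.3 with Example 1.1.3 (p. 14)] -/
theorem contDiff_of_iteratedFDeriv_tendsto_zero_zeroSection {f : F × P → E}
    (hf : ContDiffOn ℝ ∞ f {q : F × P | q.1 ≠ 0}) (h0 : ∀ z : P, f (0, z) = 0)
    (hflat : ∀ (n : ℕ) (z : P), Tendsto (fun q => iteratedFDeriv ℝ n f q) (𝓝[{q : F × P | q.1 ≠ 0}] (0, z)) (𝓝 0)) :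
    ContDiff ℝ ∞ f ∧ ∀ (n : ℕ) (z : P), iteratedFDeriv ℝ n f (0, z) = 0 := by
  have hs : IsOpen {q : F × P | q.1 ≠ 0} := isOpen_ne_fun continuous_fst continuous_const
  have H := iteratedFDeriv_zeroSection_eq_zero_and_hasFDerivAt hf h0 hflat
  refine ⟨contDiff_of_differentiable_iteratedFDeriv fun m _ q => ?_, fun n z => (H n).1 z⟩
  by_cases hq : q.1 = 0
  · rw [show q = ((0 : F), q.2) from Prod.ext hq rfl]
    exact ((H m).2 q.2).differentiableAt
  · exact (hf.contDiffAt (hs.mem_nhds hq)).differentiableAt_iteratedFDeriv (by exact_mod_cast ENat.coe_lt_top m)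

/-- **B7 (i), bound currency.**  The flatness hypothesis in the form a consumer usually produces it: near every section point, off the section,
`‖Dⁿf q‖ ≤ C · ‖q.1‖` (one constant per order and section point). [cite: HormanderALPDO1, §1.1 (1.1.2)″ (p. 9); §1.2 Lemma 1.2.3 with Example 1.1.3 (p. 14)] -/
theorem contDiff_of_norm_iteratedFDeriv_le_zeroSection {f : F × P → E}
    (hf : ContDiffOn ℝ ∞ f {q : F × P | q.1 ≠ 0}) (h0 : ∀ z : P, f (0, z) = 0)
    (hbd : ∀ (n : ℕ) (z : P), ∃ C : ℝ, ∀ᶠ q in 𝓝[{q : F × P | q.1 ≠ 0}] (0, z), ‖iteratedFDeriv ℝ n f q‖ ≤ C * ‖q.1‖) :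
    ContDiff ℝ ∞ f ∧ ∀ (n : ℕ) (z : P), iteratedFDeriv ℝ n f (0, z) = 0 := by
  refine contDiff_of_iteratedFDeriv_tendsto_zero_zeroSection hf h0 fun n z => ?_
  obtain ⟨C, hC⟩ := hbd n z
  -- `‖q.1‖ → 0` at `(0, z)`
  have h2 : Tendsto (fun q : F × P => C * ‖q.1‖) (𝓝[{q : F × P | q.1 ≠ 0}] (0, z)) (𝓝 0) := by
    have hc : Continuous fun q : F × P => C * ‖q.1‖ := by fun_prop
    have := hc.tendsto (0, z)
    simp only [norm_zero, mul_zero] at this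
    exact this.mono_left nhdsWithin_le_nhds
  exact squeeze_zero_norm' hC h2

/-! ## §3 B7 (ii): all derivatives vanish on the section ⇒ every derivative is `O(‖q.1‖^N)` near the section -/

/-- Norms of nested iterated derivatives: `‖Dʲ(Dⁿf)(x)‖ = ‖Dⁿ⁺ʲf(x)‖` (the curry isometries). [cite: HormanderALPDO1, §1.1 (the norm-preserving identification of nested multilinear forms, p. 11)] -/
theorem norm_iteratedFDeriv_iteratedFDeriv_eq_norm {X : Type*} [NormedAddCommGroup X] [NormedSpace ℝ X] (f : X → E) (n j : ℕ) (x : X) :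
    ‖iteratedFDeriv ℝ j (iteratedFDeriv ℝ n f) x‖ = ‖iteratedFDeriv ℝ (n + j) f x‖ := by
  induction j generalizing n with
  | zero => simp
  | succ j ih =>
    rw [← norm_iteratedFDeriv_fderiv, fderiv_iteratedFDeriv, LinearIsometryEquiv.norm_iteratedFDeriv_comp_left, ih (n + 1),
      show n + 1 + j = n + (j + 1) by omega]

/-- **Zero-order flat estimate.**  If `h : F × P → E` is `C^∞` and ALL its iterated derivatives vanish on the zero section `{0} × P`, then for every `N` and every
section point `(0, z₀)`: `‖h q‖ ≤ ‖q.1‖ ^ N` for `q` near `(0, z₀)` — Taylor's formula of order `N` on the `F`-segment `s ↦ (s • q.1, q.2)` with the ZERO Taylor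
polynomial at `s = 0`, the `N`-th derivative bounded by `1 · ‖q.1‖^N` on a small ball by continuity (its value on the section is `0`). [cite: HormanderALPDO1, §1.1 Taylor's formula (1.1.7)–(1.1.8), (1.1.7)′ (pp. 12–13)] -/
theorem norm_le_norm_fst_pow_of_zeroSection {h : F × P → E} (hh : ContDiff ℝ ∞ h)
    (hflat : ∀ (k : ℕ) (z : P), iteratedFDeriv ℝ k h (0, z) = 0) (N : ℕ) (z₀ : P) :
    ∀ᶠ q in 𝓝 ((0, z₀) : F × P), ‖h q‖ ≤ ‖q.1‖ ^ N := by
  -- `‖D^N h‖ < 1` on a ball around `(0, z₀)` (continuity; the value there is `0`)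
  have hcont : ContinuousAt (fun q => iteratedFDeriv ℝ N h q) ((0, z₀) : F × P) :=
    (hh.continuous_iteratedFDeriv (m := N) (by exact_mod_cast le_top)).continuousAt
  have hlt : ∀ᶠ q in 𝓝 ((0, z₀) : F × P), ‖iteratedFDeriv ℝ N h q‖ < 1 := by
    have h1 : Metric.ball (iteratedFDeriv ℝ N h ((0, z₀) : F × P)) 1 ∈ 𝓝 (iteratedFDeriv ℝ N h ((0, z₀) : F × P)) := Metric.ball_mem_nhds _ one_pos
    filter_upwards [hcont.preimage_mem_nhds h1] with q hq
    simpa [hflat N z₀] using hq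
  obtain ⟨r, hr, hball⟩ := Metric.eventually_nhds_iff_ball.1 hlt
  refine Metric.eventually_nhds_iff_ball.2 ⟨r, hr, fun q hq => ?_⟩
  -- the `F`-segment from `(0, q.2)` to `q` stays in the ball (sup norm on the product)
  have hseg : ∀ s ∈ Icc (0 : ℝ) 1, (((0 : F), q.2) + s • (q.1, (0 : P)) : F × P) ∈ Metric.ball ((0, z₀) : F × P) r := by
    intro s hs
    rw [Metric.mem_ball, dist_eq_norm] at hq ⊢
    have hpt : (((0 : F), q.2) + s • (q.1, (0 : P)) : F × P) - (0, z₀) = (s • q.1, q.2 - z₀) := by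
      ext <;> simp
    rw [hpt, Prod.norm_mk]
    have hq' : max ‖q.1‖ ‖q.2 - z₀‖ < r := by
      have hq2 := hq
      rwa [show q - ((0, z₀) : F × P) = (q.1, q.2 - z₀) from by ext <;> simp, Prod.norm_mk] at hq2
    refine lt_of_le_of_lt (max_le_max ?_ le_rfl) hq'
    rw [norm_smul, Real.norm_eq_abs, abs_of_nonneg hs.1]
    exact mul_le_of_le_one_left (norm_nonneg _) hs.2
  -- the segment function and its derivatives
  set φ : ℝ → E := fun s => h (((0 : F), q.2) + s • (q.1, (0 : P))) with hφ
  have hφs : ContDiff ℝ ∞ φ := hh.comp (contDiff_const.add (contDiff_id.smul contDiff_const))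
  have hderiv : ∀ (k : ℕ) (s : ℝ), iteratedDeriv k φ s = iteratedFDeriv ℝ k h (((0 : F), q.2) + s • (q.1, (0 : P))) fun _ => (q.1, (0 : P)) :=
    fun k s => iteratedDeriv_lineRestriction (hh.of_le (by exact_mod_cast le_top)) _ _ s
  have hφ1 : φ 1 = h q := by
    simp only [hφ, one_smul, Prod.mk_add_mk, add_zero, zero_add, Prod.mk.eta]
  rcases N with _ | N'
  · -- order `0`: `‖h q‖ < 1`
    have := hball q hq
    rw [norm_iteratedFDeriv_zero] at this
    simpa using this.le
  · -- Taylor of order `N'` with remainder of order `N' + 1`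
    have hwithin : ∀ (k : ℕ) (y : ℝ), y ∈ Icc (0 : ℝ) 1 → iteratedDerivWithin k φ (Icc 0 1) y = iteratedDeriv k φ y := fun k y hy =>
      iteratedDerivWithin_eq_iteratedDeriv (uniqueDiffOn_Icc zero_lt_one) (hφs.contDiffAt.of_le (by exact_mod_cast le_top)) hy
    have hC : ∀ y ∈ Icc (0 : ℝ) 1, ‖iteratedDerivWithin (N' + 1) φ (Icc 0 1) y‖ ≤ ‖q.1‖ ^ (N' + 1) := by
      intro y hy
      rw [hwithin _ y hy, hderiv]
      refine (ContinuousMultilinearMap.le_opNorm _ _).trans ?_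
      rw [Finset.prod_const, Finset.card_univ, Fintype.card_fin, Prod.norm_mk, norm_zero, max_eq_left (norm_nonneg _)]
      exact mul_le_of_le_one_left (pow_nonneg (norm_nonneg _) _) (hball _ (hseg y hy)).le
    have hT := taylor_mean_remainder_bound (f := φ) (a := 0) (b := 1) (x := 1) (n := N') zero_le_one
      (hφs.contDiffOn.of_le (by exact_mod_cast le_top)) (right_mem_Icc.2 zero_le_one) hC
    -- the Taylor polynomial at `0` vanishes
    have hpoly : taylorWithinEval φ N' (Icc 0 1) 0 1 = 0 := by
      rw [taylor_within_apply]
      refine Finset.sum_eq_zero fun k _ => ?_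
      rw [hwithin k 0 (left_mem_Icc.2 zero_le_one), hderiv, zero_smul, add_zero, hflat k q.2, zero_apply, smul_zero]
    rw [hpoly, sub_zero, hφ1, sub_zero, one_pow, mul_one] at hT
    exact hT.trans (div_le_self (pow_nonneg (norm_nonneg _) _) (by exact_mod_cast Nat.one_le_iff_ne_zero.2 (Nat.factorial_ne_zero N')))

/-- **B7 (ii) — FLAT ⇒ SUPER-POLYNOMIALLY SMALL, ALL DERIVATIVES.**  If `f : F × P → E` is `C^∞` and all its iterated derivatives vanish on the zero section
`{0} × P`, then for every order `n`, every exponent `N` and every section point `(0, z₀)`, `Dⁿf = O(‖q.1‖^N)` near `(0, z₀)` (indeed `‖Dⁿf q‖ ≤ ‖q.1‖^N` nearby). [cite: HormanderALPDO1, §1.1 Taylor's formula (1.1.7)–(1.1.8), (1.1.7)′ (pp. 12–13)] -/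
theorem isBigO_iteratedFDeriv_norm_fst_pow_of_zeroSection {f : F × P → E} (hf : ContDiff ℝ ∞ f)
    (hflat : ∀ (n : ℕ) (z : P), iteratedFDeriv ℝ n f (0, z) = 0) (n N : ℕ) (z₀ : P) :
    (fun q => iteratedFDeriv ℝ n f q) =O[𝓝 ((0, z₀) : F × P)] fun q => ‖q.1‖ ^ N := by
  have hg : ContDiff ℝ ∞ (iteratedFDeriv ℝ n f) := hf.iteratedFDeriv_right (by exact_mod_cast le_top)
  have hgflat : ∀ (k : ℕ) (z : P), iteratedFDeriv ℝ k (iteratedFDeriv ℝ n f) (0, z) = 0 := fun k z => by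
    rw [← norm_eq_zero, norm_iteratedFDeriv_iteratedFDeriv_eq_norm, hflat, norm_zero]
  refine IsBigO.of_bound 1 ?_
  filter_upwards [norm_le_norm_fst_pow_of_zeroSection hg hgflat N z₀] with q hq
  rwa [one_mul, Real.norm_of_nonneg (pow_nonneg (norm_nonneg _) _)]

end Literature.Analysis.Calculus

end
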